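import Summits.ResolutionOfSingularities.ResolutionOfSingularities.Theorems.RadicialJungCleanModelsGiraudStepColength
import Summits.ResolutionOfSingularities.ResolutionOfSingularities.Theorems.RadicialJungCleanModelsGiraudNonCrossingData
import Summits.ResolutionOfSingularities.ResolutionOfSingularities.Theorems.RadicialJungCleanModelsGiraudLogJacobianPBasis
import Summits.ResolutionOfSingularities.ResolutionOfSingularities.Theorems.RadicialJungCleanModelsLogContentIdealBlowup
import Literature.AlgebraicGeometry.Resolution.RegularLocalRingsUFD
import HarnessLib

/-!
# Route `RadicialJung`, crux `CleanModels` (stmt-15917): Giraud's Lemme 2.3 at one point of the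
# blow-up — the colength comparison `c(X′, f′, ξ′)` vs `c(X, f, ξ)` in chart algebra
# (T2: the algebraic core of `stub_lemma23`)

Support file (OURS) for PROGRAMME-clean-dim2 / T2 (`stub_step ≡ stub_lemma23` after
res-D-pv-030's `…T2StepOfLemma23.lean`), line `via-clean-models` of the crux `DescentPerfectToAll`
(stmt-0549). Nothing here is a statement of Hironaka's manuscript.

J. Giraud, Bull. SMF 111 (1983), Lemme 2.3, at ONE point `ξ′` over `ξ`, in the algebra of the
scheme→chart bridge (res-D-pv-030, `…T2BlowupStalkChart(Loc).lean`): inside the function field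
`K`, `R = 𝒪_{X,ξ} ≤ T = 𝒪_{X′,ξ′}`, `R` regular local of dimension `2`, `𝔪 = (x, y)` the snc
coordinates of `E(f)` at `ξ`, `T` a localization of `A = R[y/x]` (resp. `R[x/y]`) at a maximal
`Q`; `c = giraudColength` of the intrinsic `logDerivJacobianIdeal`. Inputs: a `p`-basis `Γ ∋ x, y`
of `R` with dual derivations (a PARAMETER), the chart dictionary (C1)/(C2) of
`RadicialJungCleanModelsLogContentIdealBlowup.lean` (res-L0-w81-pv-2), `B(J)` and `(D₀, B)`
(`…GiraudLogJacobianStructure.lean`, `…GiraudNonCrossingData.lean`, 2.6 = `giraud_exactness`), the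
point bounds B4 (`…GiraudStepColength.lean`). The critical primes of `f` in `R` and the shape of
`J(T, f′, E(f′))` are HYPOTHESES (`hcritR`, `hJT`) — geometry of `E(f′) = π⁻¹E(f)` (B2/B5-d).

* `giraudColength_lt_of_nonCrossing_chart` — (ii)+(iii), `ξ` non-crossing, `ξ′` in the chart of
  the exceptional equation `x`: **`c′ < c`**;
* `giraudColength_le_of_nonCrossing_oppositeChart` — (ii), `ξ′` = the origin of the other chart
  (the crossing point of `E(f′)`): **`c′ ≤ c`**;
* `giraudColength_lt_of_crossing_chart` — (i), `ξ` a crossing point: **`c′ < c`**;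
* `logDerivJacobianIdeal_eq_span_log`, `logDerivJacobianIdeal_eq_span_log₂` — adapters from the
  list of critical primes of `(T, f′)` (geometry of `E(f′) = π⁻¹E(f)`) to the hypotheses `hJT`.

References: J. Giraud, Bull. SMF 111 (1983), Lemme 2.3, 2.5, 2.6 [Giraud1983].
-/

noncomputable section

set_option linter.dupNamespace false -- mandated namespace of this single-conjunct summit

open IsLocalRing Literature.RingTheory.PBasis Literature.AlgebraicGeometry.Resolution

namespace Summit.ResolutionOfSingularities.ResolutionOfSingularities.Theorems.RadicialJung.CleanModels

universe u

/-! ## Small helpers -/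

section Helpers

/-- **The order of a nonzero ideal**: for `0 ≠ D ⊆ 𝔪` in a noetherian local ring there is
`m ≥ 1` with `D ⊆ 𝔪ᵐ`, `D ⊄ 𝔪ᵐ⁺¹` (Krull's intersection theorem). [folklore] -/
theorem exists_le_pow_not_le_pow_succ {R : Type u} [CommRing R] [IsNoetherianRing R] [IsLocalRing R]
    {D : Ideal R} (hD0 : D ≠ ⊥) (hD : D ≤ maximalIdeal R) :
    ∃ m : ℕ, 1 ≤ m ∧ D ≤ maximalIdeal R ^ m ∧ ¬ D ≤ maximalIdeal R ^ (m + 1) := by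
  classical
  obtain ⟨d, hdD, hd0⟩ := Submodule.exists_mem_ne_zero_of_ne_bot hD0
  have hex : ∃ n : ℕ, ¬ D ≤ maximalIdeal R ^ n := by
    by_contra hall
    push Not at hall
    apply hd0
    have hmem : d ∈ ⨅ n : ℕ, maximalIdeal R ^ n := Ideal.mem_iInf.mpr fun n => hall n hdD
    rwa [Ideal.iInf_pow_eq_bot_of_isLocalRing _ (maximalIdeal.isMaximal R).ne_top,
      Ideal.mem_bot] at hmem
  let n := Nat.find hex
  have hn : ¬ D ≤ maximalIdeal R ^ n := Nat.find_spec hex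
  have hn2 : 2 ≤ n := by
    by_contra hlt
    push Not at hlt
    interval_cases h : n
    · exact hn (by rw [pow_zero, Ideal.one_eq_top]; exact le_top)
    · exact hn (by rw [pow_one]; exact hD)
  refine ⟨n - 1, by omega, ?_, by rw [show n - 1 + 1 = n by omega]; exact hn⟩
  have := Nat.find_min hex (m := n - 1) (by omega)
  push Not at this
  exact this

/-- The pair of dual derivations of `x, y ∈ Γ` in the `Fin 2`-indexing of the chart dictionary.
[folklore] -/
theorem dual_pair_vecCons {R : Type u} [CommRing R] {Γ : Set R} (δ : Γ → Derivation ℤ R R)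
    (hδ₁ : ∀ γ : Γ, δ γ (γ : R) = 1) (hδ₀ : ∀ γ γ' : Γ, γ' ≠ γ → δ γ (γ' : R) = 0)
    {x y : R} (hx : x ∈ Γ) (hy : y ∈ Γ) (hxy : x ≠ y) :
    ∀ i j : Fin 2, (![δ ⟨x, hx⟩, δ ⟨y, hy⟩] i) (![x, y] j) = if i = j then 1 else 0 := by
  have h01 : δ ⟨x, hx⟩ y = 0 := hδ₀ ⟨x, hx⟩ ⟨y, hy⟩ (fun e => hxy (congrArg Subtype.val e).symm)
  have h10 : δ ⟨y, hy⟩ x = 0 := hδ₀ ⟨y, hy⟩ ⟨x, hx⟩ (fun e => hxy (congrArg Subtype.val e))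
  have h00 : δ ⟨x, hx⟩ x = 1 := hδ₁ ⟨x, hx⟩
  have h11 : δ ⟨y, hy⟩ y = 1 := hδ₁ ⟨y, hy⟩
  intro i j
  fin_cases i <;> fin_cases j <;> simp [h00, h01, h10, h11]

/-- In `ℕ∞`: `a + 1 ≤ b` with `b ≠ ⊤` gives `a < b`. [folklore] -/
theorem ENat.lt_of_add_one_le_of_ne_top {a b : ℕ∞} (h : a + 1 ≤ b) (hb : b ≠ ⊤) : a < b := by
  have ha : a ≠ ⊤ := by rintro rfl; exact hb (top_le_iff.mp (le_trans le_self_add h))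
  exact (ENat.add_one_le_iff ha).mp h

/-- **From the critical primes to the shape of `J(O, g, E(g))`, one branch**: if the critical
primes of `g` are exactly `{(z)}`, then `J(O, g, E(g))` is spanned by the `D g` with `z ∣ D z`
(the hypothesis `hJT` of `giraudColength_lt_of_nonCrossing_chart`). [cite: Giraud1983, 1.1 (3)] -/
theorem logDerivJacobianIdeal_eq_span_log {O : Type u} [CommRing O] (g : O) {z : O}
    (hcrit : ∀ P : Ideal O, P ∈ derivCriticalPrimes O g ↔ P = Ideal.span {z}) :
    logDerivJacobianIdeal O g = Ideal.span {w : O | ∃ D : Derivation ℤ O O, z ∣ D z ∧ D g = w} := by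
  unfold logDerivJacobianIdeal
  congr 1
  ext w
  simp only [Set.mem_setOf_eq]
  constructor
  · rintro ⟨D, hD, rfl⟩
    exact ⟨D, (forall_mem_span_singleton_iff_dvd D z).mp (hD _ ((hcrit _).mpr rfl)), rfl⟩
  · rintro ⟨D, hD, rfl⟩
    refine ⟨D, fun P hP => ?_, rfl⟩
    rw [(hcrit P).mp hP]
    exact (forall_mem_span_singleton_iff_dvd D z).mpr hD

/-- **Two (possible) branches with unit guards**: if the critical primes of `g` are exactly the
`(zᵢ)` for the NON-UNIT `zᵢ` among `z₁, z₂`, then `J(O, g, E(g))` is spanned by the `D g` with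
`z₁ ∣ D z₁` and `z₂ ∣ D z₂` (a unit divides everything) — the hypothesis `hJT` of
`giraudColength_lt_of_crossing_chart` / `giraudColength_le_of_nonCrossing_oppositeChart`, valid
on the whole chart. [cite: Giraud1983, 1.1 (3)] -/
theorem logDerivJacobianIdeal_eq_span_log₂ {O : Type u} [CommRing O] (g : O) {z₁ z₂ : O}
    (hcrit : ∀ P : Ideal O, P ∈ derivCriticalPrimes O g ↔
      ((¬ IsUnit z₁ ∧ P = Ideal.span {z₁}) ∨ (¬ IsUnit z₂ ∧ P = Ideal.span {z₂}))) :
    logDerivJacobianIdeal O g =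
      Ideal.span {w : O | ∃ D : Derivation ℤ O O, z₁ ∣ D z₁ ∧ z₂ ∣ D z₂ ∧ D g = w} := by
  unfold logDerivJacobianIdeal
  congr 1
  ext w
  simp only [Set.mem_setOf_eq]
  constructor
  · rintro ⟨D, hD, rfl⟩
    refine ⟨D, ?_, ?_, rfl⟩
    · by_cases hu : IsUnit z₁
      · exact hu.dvd
      · exact (forall_mem_span_singleton_iff_dvd D z₁).mp (hD _ ((hcrit _).mpr (Or.inl ⟨hu, rfl⟩)))
    · by_cases hu : IsUnit z₂
      · exact hu.dvd
      · exact (forall_mem_span_singleton_iff_dvd D z₂).mp (hD _ ((hcrit _).mpr (Or.inr ⟨hu, rfl⟩)))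
  · rintro ⟨D, hD₁, hD₂, rfl⟩
    refine ⟨D, fun P hP => ?_, rfl⟩
    rcases (hcrit P).mp hP with ⟨-, hP'⟩ | ⟨-, hP'⟩
    · rw [hP']; exact (forall_mem_span_singleton_iff_dvd D z₁).mpr hD₁
    · rw [hP']; exact (forall_mem_span_singleton_iff_dvd D z₂).mpr hD₂

end Helpers

/-! ## The setting -/

section Point

variable {K : Type u} [Field K] {R T : Subring K} [IsRegularLocalRing R] {x y : R}
  {p : ℕ} [Fact p.Prime] [CharP R p] {Γ : Set R}
  (δ : Γ → Derivation ℤ R R) (hδ₁ : ∀ γ : Γ, δ γ (γ : R) = 1)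
  (hδ₀ : ∀ γ γ' : Γ, γ' ≠ γ → δ γ (γ' : R) = 0) (hx : x ∈ Γ) (hy : y ∈ Γ)

include hδ₁ hδ₀ hx hy in
/-- **Lemme 2.3 (ii)+(iii), non-crossing `ξ`, `ξ′` on the chart of the exceptional equation `x`:
`c(X′, f′, ξ′) < c(X, f, ξ)`.** Setting: `R ≤ T ⊆ K`, `R` regular local of dimension `2`,
`𝔪 = (x, y)`, `p`-basis `Γ ∋ x, y` with dual derivations, `Ω[R⁄ℤ]` projective, `Frac R = K`;
`T` a localization of `A = R[y/x]` at a maximal `Q ∋ x`, stable under the relevant derivations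
of `K`; `f ∈ R ∖ R^p`; the critical primes of `f` in `R` are `{(x)}` (`E(f) = div(x)` at `ξ`),
`c(ξ) ≠ 0`, and `J(T, f′, E(f′)) = {D f′ : x ∣ D x}T` (only the exceptional branch through `ξ′`).
[cite: Giraud1983, Lemme 2.3 (ii)–(iii), 2.5, 2.6] -/
theorem giraudColength_lt_of_nonCrossing_chart (hdim : ringKrullDim R = 2)
    (hm : maximalIdeal R = Ideal.span {x, y}) (hxy : x ≠ y)
    (hΓ : IsPBasisOver p (frobenius R p).range Γ)
    [Module.Projective R Ω[R⁄ℤ]] [IsFractionRing R K]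
    (hRT : R ≤ T) (hAT : chartAdjoin (K := K) x y ≤ T)
    (hT : ∀ D : Derivation ℤ K K, (∀ r : R, D r ∈ R) → D (((y : R) : K) / x) ∈ T → ∀ t : T, D t ∈ T)
    [Algebra (chartAdjoin (K := K) x y) T]
    (halgT : algebraMap (chartAdjoin (K := K) x y) T = Subring.inclusion hAT)
    (Q : Ideal (chartAdjoin (K := K) x y)) [Q.IsMaximal] (hxQ : chartIncl x y x ∈ Q)
    [IsLocalization.AtPrime T Q]
    (f : R) (hf : f ∉ (frobenius R p).range)
    (hcritR : ∀ P : Ideal R, P ∈ derivCriticalPrimes R f ↔ P = Ideal.span {x})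
    (hc : giraudColength R f ≠ 0)
    (hJT : logDerivJacobianIdeal T (Subring.inclusion hRT f) =
      Ideal.span {w : T | ∃ D : Derivation ℤ T T,
        Subring.inclusion hRT x ∣ D (Subring.inclusion hRT x) ∧ D (Subring.inclusion hRT f) = w}) :
    giraudColength T (Subring.inclusion hRT f) < giraudColength R f := by
  classical
  haveI : IsDomain R := inferInstance
  haveI : UniqueFactorizationMonoid R := uniqueFactorizationMonoid_of_isRegularLocalRing R ‹_›
  have hx0 : x ≠ 0 := fun h => fst_not_mem_sq hdim hm (by rw [h]; exact Ideal.zero_mem _)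
  have hx0K : ((x : R) : K) ≠ 0 := fun e => hx0 (Subtype.ext e)
  have hxm : x ∈ maximalIdeal R := hm ▸ Ideal.subset_span (by simp)
  have hxp : Prime x := (prime_and_not_dvd_of_maximalIdeal_eq_span_pair hdim hm).1
  have hyx : ((y : R) : K) / x ∈ T := hAT (Algebra.subset_adjoin (Set.mem_singleton _))
  -- `J(R, f, E(f))` in `p`-basis form
  set Nset : Set R := {v : R | ∃ γ : Γ, (γ : R) ≠ x ∧ (γ : R) ≠ y ∧ δ γ f = v} with hNset
  have hJR : logDerivJacobianIdeal R f = Ideal.span ({x * δ ⟨x, hx⟩ f, δ ⟨y, hy⟩ f} ∪ Nset) :=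
    logDerivJacobianIdeal_eq_span_dual_of_criticalPrimes_eq δ hδ₁ hδ₀ hx hy hΓ hxy f hcritR
  have hxP : ∀ P ∈ derivCriticalPrimes R f, x ∈ P := fun P hP => by
    rw [(hcritR P).mp hP]; exact Ideal.mem_span_singleton_self x
  have hJne : logDerivJacobianIdeal R f ≠ ⊥ := logDerivJacobianIdeal_ne_bot δ hδ₁ hδ₀ hΓ hf hx0 hxP
  -- `B(J) = (xᵃ)` and `D(J) ⊆ 𝔪`
  obtain ⟨a, hB, -, -⟩ :=
    exists_principalHullIdeal_logDerivJacobianIdeal_eq_span_pow hxp f hcritR hJne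
  have hcle : coprincipalPart (logDerivJacobianIdeal R f) ≤ maximalIdeal R :=
    IsLocalRing.le_maximalIdeal (fun htop => hc ((giraudColength_eq_zero_iff f).mpr htop))
  rw [hJR] at hB hcle hJne
  -- the data `(D₀, B)`
  obtain ⟨D₀, B, -, -, h3, h4, -, h6, h7⟩ :=
    exists_nonCrossing_data δ hδ₁ hδ₀ hx hy hm hΓ hxp f hB hcle
  -- the order `m` of `D = D₀ + (B)` and finiteness
  have hD0 : D₀ ⊔ Ideal.span {B} ≠ ⊥ := by
    intro h0
    apply hJne
    rw [eq_span_singleton_mul_coprincipalPart hB, h3, h0, Ideal.mul_bot]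
  obtain ⟨m, hm1, hDm, hDm'⟩ := exists_le_pow_not_le_pow_succ hD0 h6
  have hfin : IsFiniteLength R (R ⧸ (D₀ ⊔ Ideal.span {B})) := by
    rw [← h3]
    exact isFiniteLength_quotient_coprincipalPart_of_isRegularLocalRing hdim hJne
  -- `J(T, f′, E(f′))` through (C2)
  have hN : Ideal.span {v : R | ∃ D : Derivation ℤ R R, D x = 0 ∧ D y = 0 ∧ D f = v} =
      Ideal.span Nset := span_nullDerivation_apply_eq_span_dual δ hδ₁ hδ₀ hx hy hΓ f
  have hδ' := dual_pair_vecCons δ hδ₁ hδ₀ hx hy hxy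
  have hC2 := span_logDerivation_chart_eq_map hRT f (δ := ![δ ⟨x, hx⟩, δ ⟨y, hy⟩]) hδ' hx0K hyx hT
  have hJT' : logDerivJacobianIdeal T (Subring.inclusion hRT f) =
      Ideal.span {Subring.inclusion hRT (x ^ a)} *
        (((D₀ ⊔ Ideal.span {x * B}).map (chartIncl (K := K) x y)).map
          (algebraMap (chartAdjoin (K := K) x y) T)) := by
    rw [hJT, hC2, hN]
    simp only [Matrix.cons_val_zero, Matrix.cons_val_one]
    rw [← Ideal.span_union, h4, Ideal.map_mul, Ideal.map_span, Set.image_singleton,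
      Ideal.map_map, halgT]
    rfl
  -- the point bound on the chart of `x`
  letI : Algebra R (chartAdjoin (K := K) x y) := (chartIncl x y).toAlgebra
  have halg : algebraMap R (chartAdjoin (K := K) x y) = chartIncl x y := rfl
  have hex : m = 1 → ¬ D₀ ≤ maximalIdeal R ^ 2 → D₀ ≤ Ideal.span {x} ⊔ maximalIdeal R ^ 2 :=
    fun _ _ => h7
  rcases colength_nonCrossing_chart (K := K) hdim hm hm1 hDm hDm' hfin hex halg Q hxQ T hJT' with
    hlt | htop
  · -- `c′ + 1 ≤ c`
    have hcR : giraudColength R f = Module.length R (R ⧸ (D₀ ⊔ Ideal.span {B})) := by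
      unfold giraudColength; rw [hJR, h3]
    rw [hcR]
    refine ENat.lt_of_add_one_le_of_ne_top hlt (Module.length_ne_top_iff.mpr hfin)
  · -- `D(J′) = ⊤`: `c′ = 0 < c`
    have h0 : giraudColength T (Subring.inclusion hRT f) = 0 :=
      (giraudColength_eq_zero_iff _).mpr htop
    rw [h0]
    exact pos_iff_ne_zero.mpr hc

include hδ₁ hδ₀ hx hy in
/-- **Lemme 2.3 (ii), non-crossing `ξ`, `ξ′` = the origin of the other chart** (`A′ = R[x/y]`,
the crossing point of `E(f′)`, where both the exceptional curve `y = 0` and the strict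
transform `x/y = 0` of `E(f)` pass): **`c(X′, f′, ξ′) ≤ c(X, f, ξ)`** (there the flag `δ` drops
from `1` to `0`). Hypothesis `hJT`: `J(T, f′, E(f′)) = {D f′ : y ∣ D y, x/y ∣ D(x/y)}T`.
[cite: Giraud1983, Lemme 2.3 (ii), 2.5] -/
theorem giraudColength_le_of_nonCrossing_oppositeChart (hdim : ringKrullDim R = 2)
    (hm : maximalIdeal R = Ideal.span {x, y}) (hxy : x ≠ y)
    (hΓ : IsPBasisOver p (frobenius R p).range Γ)
    [Module.Projective R Ω[R⁄ℤ]] [IsFractionRing R K]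
    (hRT : R ≤ T) (hAT : chartAdjoin (K := K) y x ≤ T) (hxyT : ((x : R) : K) / y ∈ T)
    (hT : ∀ D : Derivation ℤ K K, (∀ r : R, D r ∈ R) → D (((x : R) : K) / y) ∈ T → ∀ t : T, D t ∈ T)
    [Algebra (chartAdjoin (K := K) y x) T]
    (halgT : algebraMap (chartAdjoin (K := K) y x) T = Subring.inclusion hAT)
    (Q : Ideal (chartAdjoin (K := K) y x)) [Q.IsMaximal] [IsLocalization.AtPrime T Q]
    (f : R) (hf : f ∉ (frobenius R p).range)
    (hcritR : ∀ P : Ideal R, P ∈ derivCriticalPrimes R f ↔ P = Ideal.span {x})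
    (hc : giraudColength R f ≠ 0)
    (hJT : logDerivJacobianIdeal T (Subring.inclusion hRT f) =
      Ideal.span {w : T | ∃ D : Derivation ℤ T T,
        Subring.inclusion hRT y ∣ D (Subring.inclusion hRT y) ∧
        (⟨((x : R) : K) / y, hxyT⟩ : T) ∣ D ⟨((x : R) : K) / y, hxyT⟩ ∧
        D (Subring.inclusion hRT f) = w}) :
    giraudColength T (Subring.inclusion hRT f) ≤ giraudColength R f := by
  classical
  haveI : IsDomain R := inferInstance
  haveI : UniqueFactorizationMonoid R := uniqueFactorizationMonoid_of_isRegularLocalRing R ‹_›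
  have hm' : maximalIdeal R = Ideal.span {y, x} := by rw [hm, Set.pair_comm]
  have hx0 : x ≠ 0 := fun h => fst_not_mem_sq hdim hm (by rw [h]; exact Ideal.zero_mem _)
  have hy0 : y ≠ 0 := fun h => fst_not_mem_sq hdim hm' (by rw [h]; exact Ideal.zero_mem _)
  have hy0K : ((y : R) : K) ≠ 0 := fun e => hy0 (Subtype.ext e)
  have hxp : Prime x := (prime_and_not_dvd_of_maximalIdeal_eq_span_pair hdim hm).1
  -- `J(R, f, E(f))` in `p`-basis form
  set Nset : Set R := {v : R | ∃ γ : Γ, (γ : R) ≠ x ∧ (γ : R) ≠ y ∧ δ γ f = v} with hNset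
  have hJR : logDerivJacobianIdeal R f = Ideal.span ({x * δ ⟨x, hx⟩ f, δ ⟨y, hy⟩ f} ∪ Nset) :=
    logDerivJacobianIdeal_eq_span_dual_of_criticalPrimes_eq δ hδ₁ hδ₀ hx hy hΓ hxy f hcritR
  have hxP : ∀ P ∈ derivCriticalPrimes R f, x ∈ P := fun P hP => by
    rw [(hcritR P).mp hP]; exact Ideal.mem_span_singleton_self x
  have hJne : logDerivJacobianIdeal R f ≠ ⊥ := logDerivJacobianIdeal_ne_bot δ hδ₁ hδ₀ hΓ hf hx0 hxP
  obtain ⟨a, hB, -, -⟩ :=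
    exists_principalHullIdeal_logDerivJacobianIdeal_eq_span_pow hxp f hcritR hJne
  have hcle : coprincipalPart (logDerivJacobianIdeal R f) ≤ maximalIdeal R :=
    IsLocalRing.le_maximalIdeal (fun htop => hc ((giraudColength_eq_zero_iff f).mpr htop))
  rw [hJR] at hB hcle hJne
  obtain ⟨D₀, B, -, -, h3, -, h5, h6, -⟩ :=
    exists_nonCrossing_data δ hδ₁ hδ₀ hx hy hm hΓ hxp f hB hcle
  have hD0 : D₀ ⊔ Ideal.span {B} ≠ ⊥ := by
    intro h0
    apply hJne
    rw [eq_span_singleton_mul_coprincipalPart hB, h3, h0, Ideal.mul_bot]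
  obtain ⟨m, hm1, hDm, hDm'⟩ := exists_le_pow_not_le_pow_succ hD0 h6
  have hfin : IsFiniteLength R (R ⧸ (D₀ ⊔ Ideal.span {B})) := by
    rw [← h3]
    exact isFiniteLength_quotient_coprincipalPart_of_isRegularLocalRing hdim hJne
  -- `J(T, f′, E(f′))` through (C1) with the roles of `x, y` exchanged
  have hδ' := dual_pair_vecCons δ hδ₁ hδ₀ hy hx (Ne.symm hxy)
  have hC1 := map_span_logDerivation_eq_span_logDerivation_chart hRT f
    (δ := ![δ ⟨y, hy⟩, δ ⟨x, hx⟩]) hδ' hy0K hxyT hT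
  have hswap : {v : R | ∃ D : Derivation ℤ R R, y ∣ D y ∧ x ∣ D x ∧ D f = v} =
      {v : R | ∃ D : Derivation ℤ R R, x ∣ D x ∧ y ∣ D y ∧ D f = v} := by
    ext v
    constructor
    · rintro ⟨D, h1, h2, h3⟩; exact ⟨D, h2, h1, h3⟩
    · rintro ⟨D, h1, h2, h3⟩; exact ⟨D, h2, h1, h3⟩
  have hJT' : logDerivJacobianIdeal T (Subring.inclusion hRT f) =
      Ideal.span {Subring.inclusion hRT (x ^ a)} *
        (((D₀ ⊔ Ideal.span {y * B}).map (chartIncl (K := K) y x)).map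
          (algebraMap (chartAdjoin (K := K) y x) T)) := by
    rw [hJT, ← hC1, hswap, span_logDerivation₂_apply_eq_span_dual δ hδ₁ hδ₀ hx hy hΓ hxy f, h5,
      Ideal.map_mul, Ideal.map_span, Set.image_singleton, Ideal.map_map, halgT]
    rfl
  letI : Algebra R (chartAdjoin (K := K) y x) := (chartIncl y x).toAlgebra
  have halg : algebraMap R (chartAdjoin (K := K) y x) = chartIncl y x := rfl
  have hle := colength_le_of_nonCrossing_oppositeChart (K := K) hdim hm hm1 hDm hDm' hfin halg Q
    T hJT'
  have hcR : giraudColength R f = Module.length R (R ⧸ (D₀ ⊔ Ideal.span {B})) := by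
    unfold giraudColength; rw [hJR, h3]
  exact hcR ▸ hle

include hδ₁ hδ₀ hx hy in
/-- **Lemme 2.3 (i), crossing `ξ`, `ξ′` on the chart of `x`** (for the chart of `y` exchange
the names): **`c(X′, f′, ξ′) < c(X, f, ξ)`**. Hypotheses: the critical primes of `f` in `R` are
`{(x), (y)}`; by (C1) `J(T, f′, E(f′)) = {D f′ : x ∣ D x, y/x ∣ D(y/x)}T` (at the points of the
exceptional curve where `y/x` is a unit the second condition is vacuous).
[cite: Giraud1983, Lemme 2.3 (i), Lemme 2.1.1, 2.5] -/
theorem giraudColength_lt_of_crossing_chart (hdim : ringKrullDim R = 2)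
    (hm : maximalIdeal R = Ideal.span {x, y}) (hxy : x ≠ y)
    (hΓ : IsPBasisOver p (frobenius R p).range Γ)
    [Module.Projective R Ω[R⁄ℤ]] [IsFractionRing R K]
    (hRT : R ≤ T) (hAT : chartAdjoin (K := K) x y ≤ T) (hyxT : ((y : R) : K) / x ∈ T)
    (hT : ∀ D : Derivation ℤ K K, (∀ r : R, D r ∈ R) → D (((y : R) : K) / x) ∈ T → ∀ t : T, D t ∈ T)
    [Algebra (chartAdjoin (K := K) x y) T]
    (halgT : algebraMap (chartAdjoin (K := K) x y) T = Subring.inclusion hAT)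
    (Q : Ideal (chartAdjoin (K := K) x y)) [Q.IsMaximal] [IsLocalization.AtPrime T Q]
    (f : R) (hf : f ∉ (frobenius R p).range)
    (hcritR : ∀ P : Ideal R, P ∈ derivCriticalPrimes R f ↔
      (P = Ideal.span {x} ∨ P = Ideal.span {y}))
    (hc : giraudColength R f ≠ 0)
    (hJT : logDerivJacobianIdeal T (Subring.inclusion hRT f) =
      Ideal.span {w : T | ∃ D : Derivation ℤ T T,
        Subring.inclusion hRT x ∣ D (Subring.inclusion hRT x) ∧
        (⟨((y : R) : K) / x, hyxT⟩ : T) ∣ D ⟨((y : R) : K) / x, hyxT⟩ ∧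
        D (Subring.inclusion hRT f) = w}) :
    giraudColength T (Subring.inclusion hRT f) < giraudColength R f := by
  classical
  haveI : IsDomain R := inferInstance
  haveI : UniqueFactorizationMonoid R := uniqueFactorizationMonoid_of_isRegularLocalRing R ‹_›
  have hx0 : x ≠ 0 := fun h => fst_not_mem_sq hdim hm (by rw [h]; exact Ideal.zero_mem _)
  have hx0K : ((x : R) : K) ≠ 0 := fun e => hx0 (Subtype.ext e)
  have hm' : maximalIdeal R = Ideal.span {y, x} := by rw [hm, Set.pair_comm]
  have hy0 : y ≠ 0 := fun h => fst_not_mem_sq hdim hm' (by rw [h]; exact Ideal.zero_mem _)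
  -- `J(R, f, E(f))` in `p`-basis form, nonzero, with principal `B(J)`
  set Nset : Set R := {v : R | ∃ γ : Γ, (γ : R) ≠ x ∧ (γ : R) ≠ y ∧ δ γ f = v} with hNset
  have hJR : logDerivJacobianIdeal R f = Ideal.span ({x * δ ⟨x, hx⟩ f, y * δ ⟨y, hy⟩ f} ∪ Nset) :=
    logDerivJacobianIdeal_eq_span_dual_of_criticalPrimes_eq₂ δ hδ₁ hδ₀ hx hy hΓ hxy f hcritR
  have hxyP : ∀ P ∈ derivCriticalPrimes R f, x * y ∈ P := fun P hP => by
    rcases (hcritR P).mp hP with hP' | hP'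
    · rw [hP']; exact Ideal.mul_mem_right _ _ (Ideal.mem_span_singleton_self x)
    · rw [hP']; exact Ideal.mul_mem_left _ _ (Ideal.mem_span_singleton_self y)
  have hJne : logDerivJacobianIdeal R f ≠ ⊥ :=
    logDerivJacobianIdeal_ne_bot δ hδ₁ hδ₀ hΓ hf (mul_ne_zero hx0 hy0) hxyP
  obtain ⟨g, -, -, hB⟩ := exists_principalHullIdeal_eq_span
    (I := logDerivJacobianIdeal R f) (IsNoetherian.noetherian _)
  have hsplit := eq_span_singleton_mul_coprincipalPart hB
  set D := coprincipalPart (logDerivJacobianIdeal R f) with hDdef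
  have hD0 : D ≠ ⊥ := by
    intro h0; apply hJne; rw [hsplit, h0, Ideal.mul_bot]
  have hDle : D ≤ maximalIdeal R :=
    IsLocalRing.le_maximalIdeal (fun htop => hc ((giraudColength_eq_zero_iff f).mpr htop))
  obtain ⟨m, hm1, hDm, hDm'⟩ := exists_le_pow_not_le_pow_succ hD0 hDle
  have hfin : IsFiniteLength R (R ⧸ D) :=
    isFiniteLength_quotient_coprincipalPart_of_isRegularLocalRing hdim hJne
  -- `J(T, f′, E(f′))` through (C1)
  have hδ' := dual_pair_vecCons δ hδ₁ hδ₀ hx hy hxy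
  have hC1 := map_span_logDerivation_eq_span_logDerivation_chart hRT f
    (δ := ![δ ⟨x, hx⟩, δ ⟨y, hy⟩]) hδ' hx0K hyxT hT
  have hJT' : logDerivJacobianIdeal T (Subring.inclusion hRT f) =
      Ideal.span {Subring.inclusion hRT g} *
        ((D.map (chartIncl (K := K) x y)).map (algebraMap (chartAdjoin (K := K) x y) T)) := by
    rw [hJT, ← hC1, span_logDerivation₂_apply_eq_span_dual δ hδ₁ hδ₀ hx hy hΓ hxy f, ← hJR, hsplit,
      Ideal.map_mul, Ideal.map_span, Set.image_singleton, Ideal.map_map, halgT]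
    rfl
  letI : Algebra R (chartAdjoin (K := K) x y) := (chartIncl x y).toAlgebra
  have halg : algebraMap R (chartAdjoin (K := K) x y) = chartIncl x y := rfl
  have hlt := colength_add_one_le_of_crossing (K := K) hdim hm hm1 hDm hDm' hfin halg Q T hJT'
  exact ENat.lt_of_add_one_le_of_ne_top hlt (Module.length_ne_top_iff.mpr hfin)

end Point

end Summit.ResolutionOfSingularities.ResolutionOfSingularities.Theorems.RadicialJung.CleanModels

end
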